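import Summits.BirchSwinnertonDyer.BirchSwinnertonDyer.Theorems.EisensteinPrimesBSDpOnCellCTelescopeBranchFrobeniusCharpolyTransfer
import Literature.NumberTheory.GaloisRepresentations.PatchingLemma
import Literature.NumberTheory.GaloisRepresentations.FramedRepBaseChange
import HarnessLib

/-!
# [telescope — width x2-p2 g24, 2026-08-30] SEMISIMPLE `p`-ADIC GALOIS REPRESENTATIONS WITH THE SAME FROBENIUS CHARACTERISTIC POLYNOMIALS
# ARE CONJUGATE over any coefficient field `Ω` of characteristic `0` (Chebotarev transfer `…FrobeniusCharpolyTransfer` + the tree's PROVED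
# Brauer–Nesbitt `SorensenPatching.exists_conj_of_trace_eq`) — rider TU-ident / step (D7) of T-An-2ᴴ reduced to its semisimplicity inputs
# Crux 4 `BSDpOnCellC` (stmt-BirchSwinnertonDyer-19034), line «telescope» (`--supports`, helper; closes nothing)

WHY: see `…TelescopeBranchFrobeniusCharpolyTransfer`. Hida 1986 (2.2c) reads «`π mod P_t` is equivalent to `π(f_{P_t})`», `π(f)` being THE
representation with (2.1a,b); the tree's candidate for `π(g_t)` is `(D t).Δ.ρ`, which carries (2.1a,b) (`OrdinaryNewformDatum.charpoly`). THIS FILE: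
two continuous `ρ₁, ρ₂ : Γ_F →ₜ* GL_n(A)` (`A` a topological ring whose open ideals separate points, e.g. `ℤ_p`) with the same Frobenius
characteristic polynomials off a finite `S` become CONJUGATE over any topological field `Ω` of characteristic `0` receiving `A` continuously, as
soon as both base changes `ρᵢ ⊗ Ω` are semisimple (`exists_conj_baseChange_of_hasFrobCharpolyAt`): characteristic polynomials agree on all of `Γ_F`
(`charpoly_eq_of_hasFrobCharpolyAt_of_separating`), hence traces of `ρᵢ ⊗ Ω` agree, hence Brauer–Nesbitt in characteristic `0`
(`SorensenPatching.exists_conj_of_trace_eq`). So TU-ident = «(2.1a,b) for both + semisimplicity (Ribet's irreducibility for weight ≥ 2)».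

CONTENT (namespace `…Theorems.TelescopeBranchFrobeniusConjOfCharpoly`; THEOREMS ONLY): `trace_baseChange_eq_of_charpoly_eq`,
**`exists_conj_baseChange_of_hasFrobCharpolyAt`**, and its `ℤ_p` instance **`exists_conj_baseChange_of_hasFrobCharpolyAt_padicInt`**.

HONEST FRAMING: general representation theory over binders; identifies no specific representation; closes no registered stub, no crux, no summit
statement; BSD is proved for no curve by this file. No named fact, no definition, no instance, no `sorry`.
References (shape only): [cite: SerreAbelianLadic1968, Ch. I §2.3] [cite: BourbakiAlgebreVIII2012, VIII §20 n°6 Thm. 2 Cor. 1 (Brauer–Nesbitt)] [cite: Hida1986, §2 (2.1a) (2.1b) (2.2c)]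
-/

set_option autoImplicit false
set_option linter.dupNamespace false

noncomputable section

open scoped Classical MatrixGroups
open IsDedekindDomain NumberField Field
open Literature.NumberTheory.GaloisRepresentations
  Summit.BirchSwinnertonDyer.BirchSwinnertonDyer.Theorems.TelescopeBranchFrobeniusCharpolyTransfer

namespace Summit.BirchSwinnertonDyer.BirchSwinnertonDyer.Theorems.TelescopeBranchFrobeniusConjOfCharpoly

universe u v w

variable {F : Type} [Field F] [NumberField F]
  {A : Type v} [CommRing A] [TopologicalSpace A] [IsTopologicalRing A]
  {Ω : Type w} [Field Ω] [TopologicalSpace Ω] [IsTopologicalRing Ω] [CharZero Ω] {n : ℕ}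

omit [NumberField F] [IsTopologicalRing A] [IsTopologicalRing Ω] [CharZero Ω] in
/-- If `charpoly (ρ₁ g) = charpoly (ρ₂ g)` for all `g`, the base changes along `f : A → Ω` have equal traces everywhere. [folklore] -/
theorem trace_baseChange_eq_of_charpoly_eq (f : A →+* Ω) (hf : Continuous f) (ρ₁ ρ₂ : FramedGaloisRep F A n)
    (h : ∀ g, FramedRep.charpoly ρ₁ g = FramedRep.charpoly ρ₂ g) (g : absoluteGaloisGroup F) :
    (SorensenPatching.mat (FramedRep.baseChange f hf ρ₁) g).trace = (SorensenPatching.mat (FramedRep.baseChange f hf ρ₂) g).trace := by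
  rcases Nat.eq_zero_or_pos n with hn | hn
  · subst hn
    simp [Matrix.trace]
  · haveI : Nonempty (Fin n) := ⟨⟨0, hn⟩⟩
    have hc : FramedRep.charpoly (FramedRep.baseChange f hf ρ₁) g = FramedRep.charpoly (FramedRep.baseChange f hf ρ₂) g := by
      rw [FramedRep.charpoly_baseChange, FramedRep.charpoly_baseChange, h g]
    change ((FramedRep.baseChange f hf ρ₁ g : GL (Fin n) Ω) : Matrix (Fin n) (Fin n) Ω).trace =
      ((FramedRep.baseChange f hf ρ₂ g : GL (Fin n) Ω) : Matrix (Fin n) (Fin n) Ω).trace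
    rw [Matrix.trace_eq_neg_charpoly_coeff, Matrix.trace_eq_neg_charpoly_coeff]
    change -(FramedRep.charpoly (FramedRep.baseChange f hf ρ₁) g).coeff _ = -(FramedRep.charpoly (FramedRep.baseChange f hf ρ₂) g).coeff _
    rw [hc]

set_option maxHeartbeats 800000 in
/-- **Same Frobenius characteristic polynomials + semisimple ⟹ conjugate.** `A` a topological ring whose open ideals separate points,
`ρ₁ ρ₂ : Γ_F →ₜ* GL_n(A)` with the same Frobenius characteristic polynomial at every place outside a finite `S`, `f : A → Ω` a continuous ring
map to a topological field of characteristic `0` such that both `ρᵢ ⊗_f Ω` are semisimple. Then `ρ₂ ⊗ Ω = P (ρ₁ ⊗ Ω) P⁻¹` for some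
`P ∈ GL_n(Ω)`. [cite: SerreAbelianLadic1968, Ch. I §2.3 (Corollary of Čebotarev)] [cite: BourbakiAlgebreVIII2012, VIII §20 n°6 Thm. 2 Cor. 1] -/
theorem exists_conj_baseChange_of_hasFrobCharpolyAt
    (hsep : ∀ x : A, (∀ I : Ideal A, IsOpen (I : Set A) → x ∈ I) → x = 0)
    (ρ₁ ρ₂ : FramedGaloisRep F A n) (S : Set (HeightOneSpectrum (𝓞 F))) (hS : S.Finite)
    (h : ∀ v : HeightOneSpectrum (𝓞 F), v ∉ S → ∃ P : Polynomial A, ρ₁.HasFrobCharpolyAt v P ∧ ρ₂.HasFrobCharpolyAt v P)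
    (f : A →+* Ω) (hf : Continuous f)
    (hss₁ : (FramedRep.toRepresentation (FramedRep.baseChange f hf ρ₁)).IsSemisimpleRepresentation)
    (hss₂ : (FramedRep.toRepresentation (FramedRep.baseChange f hf ρ₂)).IsSemisimpleRepresentation) :
    ∃ P : GL (Fin n) Ω, ∀ g : absoluteGaloisGroup F,
      FramedRep.baseChange f hf ρ₂ g = P * FramedRep.baseChange f hf ρ₁ g * P⁻¹ :=
  SorensenPatching.exists_conj_of_trace_eq _ _ hss₁ hss₂
    (trace_baseChange_eq_of_charpoly_eq f hf ρ₁ ρ₂ (charpoly_eq_of_hasFrobCharpolyAt_of_separating hsep ρ₁ ρ₂ S hS h))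

/-- **`ℤ_p`-coefficients**: continuous `ρ₁ ρ₂ : Γ_F →ₜ* GL_n(ℤ_p)` with the same Frobenius characteristic polynomials off a finite `S`, whose
base changes to a topological field `Ω ⊇ ℤ_p` of characteristic `0` (e.g. `ℚ_p`, `ℚ̄_p`, `ℂ_p`) are semisimple, are conjugate over `Ω`.
[cite: SerreAbelianLadic1968, Ch. I §2.3 (Corollary of Čebotarev)] -/
theorem exists_conj_baseChange_of_hasFrobCharpolyAt_padicInt {p : ℕ} [Fact p.Prime]
    (ρ₁ ρ₂ : FramedGaloisRep F ℤ_[p] n) (S : Set (HeightOneSpectrum (𝓞 F))) (hS : S.Finite)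
    (h : ∀ v : HeightOneSpectrum (𝓞 F), v ∉ S → ∃ P : Polynomial ℤ_[p], ρ₁.HasFrobCharpolyAt v P ∧ ρ₂.HasFrobCharpolyAt v P)
    (f : ℤ_[p] →+* Ω) (hf : Continuous f)
    (hss₁ : (FramedRep.toRepresentation (FramedRep.baseChange f hf ρ₁)).IsSemisimpleRepresentation)
    (hss₂ : (FramedRep.toRepresentation (FramedRep.baseChange f hf ρ₂)).IsSemisimpleRepresentation) :
    ∃ P : GL (Fin n) Ω, ∀ g : absoluteGaloisGroup F,
      FramedRep.baseChange f hf ρ₂ g = P * FramedRep.baseChange f hf ρ₁ g * P⁻¹ :=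
  exists_conj_baseChange_of_hasFrobCharpolyAt (fun _ hx => eq_zero_of_forall_mem_span_pow fun m => hx _ (isOpen_span_pow m))
    ρ₁ ρ₂ S hS h f hf hss₁ hss₂

end Summit.BirchSwinnertonDyer.BirchSwinnertonDyer.Theorems.TelescopeBranchFrobeniusConjOfCharpoly

end
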